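import Summits.BirchSwinnertonDyer.BirchSwinnertonDyer.Theorems.TameQuarticSolventTprimeThreeTorsionValuationAtThree
import Literature.NumberTheory.EllipticCurves.VariableChangePoints
import HarnessLib

/-!
# Route `TameQuarticSolvent`, crux `SolventPairLowerBound` (stmt-BirchSwinnertonDyer-21391) — sub-row B of the
# (t′) leaf has NO rational `3`-TORSION over any ultrametric field of ramification index `4·(odd)` over `ℚ₃`
# (the curve `W ⊗ K` itself, not only its good model)

HONEST FRAMING. Theorems only; helper (`--supports stmt-BirchSwinnertonDyer-21391 --as helper`) of width seat
bsd-wall-tqs-p1-w2 g7; consumer-facing transport of `TameQuarticSolventTprimeThreeTorsionValuationAtThree` (p603087,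
statements on the good model `W' ⊗ K`) to Mathlib's `W.baseChange K` through the tree's
`WeierstrassCurve.VariableChange.pointEquiv`. BSD is not proved by any of this; nothing here closes 21391 or 23963.

WHAT. `tprime_subrowB_threeTorsion_baseChange_eq_zero`: let `W/ℚ` be globally minimal, elliptic, `Addv W 3`,
`SubTprime W 3`, on SUB-ROW B (`c₆ = 0 ∨ 2·ord₃ c₆ ≠ ord₃ Δ + 3`, i.e. NOT `ord₃ c₆ = m` — the Hodge split of w3 g5's
`tprime_padicValRat_c₆_split`; 1 058 of the 7 663 (t′) classes with `N < 5·10⁵`). Let `K` be a field with an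
ultrametric absolute value, a ring map `ι : ℚ₃ → K` integral on `ℤ₃`, and an element `ϖ` with `‖ϖ‖⁴ = ‖3‖ < 1`
whose value group has ODD index over `‖ϖ‖^ℤ` (`∀ z ≠ 0, ‖z‖^{m'} ∈ ‖ϖ‖^ℤ`, `m'` odd) — every `3`-adic field
with `e ≡ 4 (mod 8)`, the completion `M_w` of the tame quartic field of line `birth` (`e = 4`), every layer
`M_w(μ_{3ⁿ})` of its `3`-cyclotomic tower. THEN **`(W ⊗ K)(K)` has no point of order `3`: `3 • P = 0 ⇒ P = 0`.**
Proof: run `tprime_goodModel_formalMul_three_dichotomy` with `O` = the valuation ring of `K`; the A-branch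
contradicts the sub-row-B hypothesis (`2m = 3k + 3`); on the B-branch `threeTorsion_eq_zero_of_subrowB_oddIndex` kills
the `3`-torsion of the good model `W' ⊗ K`, and `W' ⊗ K = (D · T_K) • (W ⊗ K)` for the diagonal change `D = (ϖᵏ, 0, 0, 0)`
and the medium-form change `T`, so `pointEquiv` transports the conclusion.

References: J.-P. Serre, Invent. Math. 15 (1972) §1; J. H. Silverman, *AEC* III.1 (Table 3.1), VII.3, Ex. 3.7.
[cite: SilvermanAEC2009, III.1 Table 3.1] [cite: SilvermanAEC2009, IV.6.1]
-/

-- D-0017: single-problem summit, so `Summit.BirchSwinnertonDyer.BirchSwinnertonDyer.…` repeats a namespace BY DESIGN.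
set_option linter.dupNamespace false

noncomputable section

namespace Summit.BirchSwinnertonDyer.BirchSwinnertonDyer.Theorems.SolventPairLowerBound

open WeierstrassCurve Literature.NumberTheory.EllipticCurves.Rank1Residual
  Summit.BirchSwinnertonDyer.Rank1Residual.Additive

section BaseChange

universe uK

variable {K : Type uK} [NormedField K] [IsUltrametricDist K]

/-- In the valuation ring `A = {‖x‖ ≤ 1}` of an ultrametric field: an element is a unit iff it has norm `1`.
[folklore] -/
theorem isUnit_valuationSubring_iff (a : (NormedField.valuation (K := K)).valuationSubring) :
    IsUnit a ↔ ‖(a : K)‖ = 1 := by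
  rw [ValuationSubring.valuation_eq_one_iff,
    ← (NormedField.valuation (K := K)).isEquiv_valuation_valuationSubring.eq_one_iff_eq_one,
    NormedField.valuation_apply, ← NNReal.coe_eq_one, coe_nnnorm]

/-- Membership in the valuation ring `A = {‖x‖ ≤ 1}`. [folklore] -/
theorem mem_valuationSubring_iff_norm (x : K) :
    x ∈ (NormedField.valuation (K := K)).valuationSubring ↔ ‖x‖ ≤ 1 := by
  change ‖x‖₊ ≤ 1 ↔ _
  rw [← NNReal.coe_le_coe, coe_nnnorm, NNReal.coe_one]

/-- **Sub-row B of the (t′) leaf: `(W ⊗ K)(K)[3] = 0` over every ultrametric `K ⊇ ℚ₃` of ramification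
`4·(odd)`.** See the module docstring. [Serre 1972 §1; Silverman AEC IV.6.1, VII.3]
[cite: SilvermanAEC2009, IV.6.1] -/
theorem tprime_subrowB_threeTorsion_baseChange_eq_zero (W : WeierstrassCurve ℚ) [W.IsElliptic]
    [W.IsGloballyMinimal] (hadd : Addv W 3) (hsub : SubTprime W 3)
    (hB : W.c₆ = 0 ∨ 2 * padicValRat 3 W.c₆ ≠ padicValRat 3 W.Δ + 3)
    [CharZero K] [DecidableEq K] (ι : ℚ_[3] →+* K) (hι : ∀ x : ℤ_[3], ‖ι x‖ ≤ 1)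
    (ϖ : K) (hϖ1 : ‖ϖ‖ < 1) (hϖ4 : ‖ϖ‖ ^ 4 = ‖(3 : K)‖)
    {m' : ℕ} (hm' : Odd m') (hval : ∀ z : K, z ≠ 0 → ∃ j : ℤ, ‖z‖ ^ m' = ‖ϖ‖ ^ j)
    (P : (W.baseChange K).toAffine.Point) (h3P : 3 • P = 0) : P = 0 := by
  classical
  -- the valuation ring `A` of `K`, `φ : ℤ₃ → A`, `ψ : A ⊆ K`
  set v : Valuation K NNReal := NormedField.valuation with hv
  set A : ValuationSubring K := v.valuationSubring with hA
  have hmemA : ∀ x : K, x ∈ A ↔ ‖x‖ ≤ 1 := mem_valuationSubring_iff_norm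
  let ψ : A →+* K := A.subtype
  have hψ : ∀ x : A, ‖ψ x‖ ≤ 1 := fun x ↦ (hmemA _).mp x.2
  let ι₀ : ℤ_[3] →+* K := ι.comp (algebraMap ℤ_[3] ℚ_[3])
  let φ : ℤ_[3] →+* A := ι₀.codRestrict A fun x ↦ (hmemA _).mpr (hι x)
  have hψφ : ∀ x, ψ (φ x) = ι₀ x := fun x ↦ rfl
  -- `3 ≠ 0` in `K`, `0 < ‖ϖ‖`
  have h3K : ‖(3 : K)‖ < 1 := by rw [← hϖ4]; exact pow_lt_one₀ (norm_nonneg _) hϖ1 four_ne_zero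
  have h30 : (3 : K) ≠ 0 := three_ne_zero
  have hϖ0 : 0 < ‖ϖ‖ := by
    refine norm_pos_iff.mpr fun h ↦ h30 ?_
    rw [h, norm_zero, zero_pow four_ne_zero] at hϖ4
    exact norm_eq_zero.mp hϖ4.symm
  -- `ϖ`, `u = 3 / ϖ⁴` in `A`
  have hϖA : ϖ ∈ A := (hmemA _).mpr hϖ1.le
  set ϖA : A := ⟨ϖ, hϖA⟩ with hϖAdef
  have hϖ40 : ϖ ^ 4 ≠ 0 := pow_ne_zero 4 (norm_pos_iff.mp hϖ0)
  have huK : ‖(3 : K) / ϖ ^ 4‖ = 1 := by rw [norm_div, norm_pow, hϖ4, div_self (norm_pos_iff.mpr h30).ne']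
  have huA : (3 : K) / ϖ ^ 4 ∈ A := (hmemA _).mpr huK.le
  set uA : A := ⟨(3 : K) / ϖ ^ 4, huA⟩ with huAdef
  have hu : IsUnit uA := (isUnit_valuationSubring_iff uA).mpr huK
  have h3 : (3 : A) = ϖA ^ 4 * uA := by
    apply Subtype.ext
    change (3 : K) = ϖ ^ 4 * ((3 : K) / ϖ ^ 4)
    rw [mul_div_cancel₀ _ hϖ40]
  have hϖnu : ¬ IsUnit ϖA := by
    rw [isUnit_valuationSubring_iff]; exact ne_of_lt hϖ1
  have hψϖ : ψ ϖA = ϖ := rfl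
  -- the good model and its dichotomy
  obtain ⟨V, T, k, m, W', hVmap, hkm, hΔval, hSa₁, hSa₃, hW'a₁, hW'a₃, ha₂, ha₄, ha₆, hunit, hcases⟩ :=
    tprime_goodModel_formalMul_three_dichotomy W hadd hsub φ hu h3 hϖnu
  -- sub-row B: the A-branch is excluded by `hB`
  have hBranch : (3 : A) ∣ W'.a₂ := by
    rcases hcases with ⟨hB1, -, -⟩ | ⟨-, ⟨hc₆, hval₆⟩, -⟩
    · exact hB1
    · exfalso
      rcases hB with h0 | hne
      · exact hc₆ h0
      · apply hne
        rw [hval₆, hΔval]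
        rcases hkm with ⟨rfl, rfl⟩ | ⟨rfl, rfl⟩ <;> norm_num
  -- no `3`-torsion on the good model over `K`
  have hval' : ∀ z : K, z ≠ 0 → ∃ j : ℤ, ‖z‖ ^ m' = ‖ψ ϖA‖ ^ j := hval
  have hgood : ∀ Q : (W'.map ψ).toAffine.Point, 3 • Q = 0 → Q = 0 :=
    threeTorsion_eq_zero_of_subrowB_oddIndex ψ hψ hu h3 (by rw [hψϖ]; exact hϖ0) (by rw [hψϖ]; exact hϖ1)
      W' hunit hW'a₁ hW'a₃ hBranch hm' hval'
  -- the `K`-isomorphism `W' ⊗ K = (D · T_K) • (W ⊗ K)`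
  set S := T • V with hS
  have hSK : (T.map ι₀) • W.baseChange K = S.map ι₀ := by
    have hVK : V.map ι₀ = W.baseChange K := by
      change V.map (ι.comp (algebraMap ℤ_[3] ℚ_[3])) = W.map (algebraMap ℚ K)
      rw [← WeierstrassCurve.map_map, hVmap, WeierstrassCurve.baseChange, WeierstrassCurve.map_map]
      congr 1
      exact Subsingleton.elim _ _
    rw [← hVK, WeierstrassCurve.map_variableChange, hS]
  have hϖk0 : (ϖ : K) ^ k ≠ 0 := pow_ne_zero k (norm_pos_iff.mp hϖ0)
  set D : VariableChange K := ⟨Units.mk0 (ϖ ^ k) hϖk0, 0, 0, 0⟩ with hD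
  have hmodel : (D * T.map ι₀) • W.baseChange K = W'.map ψ := by
    rw [mul_smul, hSK]
    have e₂ : ι₀ S.a₂ = ϖ ^ (2 * k) * ψ W'.a₂ := by
      rw [← hψφ, ← ha₂, map_mul, map_pow, hψϖ]
    have e₄ : ι₀ S.a₄ = ϖ ^ (4 * k) * ψ W'.a₄ := by
      rw [← hψφ, ← ha₄, map_mul, map_pow, hψϖ]
    have e₆ : ι₀ S.a₆ = ϖ ^ (6 * k) * ψ W'.a₆ := by
      rw [← hψφ, ← ha₆, map_mul, map_pow, hψϖ]
    have hu1 : ((D.u⁻¹ : Kˣ) : K) = (ϖ ^ k)⁻¹ := by rw [hD, Units.val_inv_eq_inv_val, Units.val_mk0]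
    ext
    · rw [variableChange_a₁, map_a₁, hSa₁, map_zero, map_a₁, hW'a₁, map_zero]; simp [hD]
    · rw [variableChange_a₂, map_a₁, map_a₂, hSa₁, map_zero, e₂, map_a₂, hu1]
      simp only [hD, mul_zero, sub_zero, add_zero, zero_pow two_ne_zero]
      field_simp
      ring
    · rw [variableChange_a₃, map_a₁, map_a₃, hSa₁, hSa₃, map_zero, map_a₃, hW'a₃, map_zero]; simp [hD]
    · rw [variableChange_a₄, map_a₁, map_a₂, map_a₃, map_a₄, hSa₁, hSa₃, map_zero, e₄, map_a₄, hu1]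
      simp only [hD, mul_zero, zero_mul, sub_zero, add_zero, zero_pow two_ne_zero]
      field_simp
      ring
    · rw [variableChange_a₆, map_a₁, map_a₂, map_a₃, map_a₄, map_a₆, hSa₁, hSa₃, map_zero, e₆,
        map_a₆, hu1]
      simp only [hD, mul_zero, zero_mul, sub_zero, add_zero, zero_pow two_ne_zero, zero_pow three_ne_zero]
      field_simp
      ring
  -- transport along `pointEquiv`
  have hgood' : ∀ Q : ((D * T.map ι₀) • W.baseChange K).toAffine.Point, 3 • Q = 0 → Q = 0 := by
    rw [hmodel]; exact hgood
  set e := VariableChange.pointEquiv (W.baseChange K) (D * T.map ι₀) with he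
  have hQ : e P = 0 := hgood' (e P) (by rw [← map_nsmul, h3P, map_zero])
  exact e.injective (by rw [hQ, map_zero])

end BaseChange

end Summit.BirchSwinnertonDyer.BirchSwinnertonDyer.Theorems.SolventPairLowerBound

end
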